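import Summits.QuantumFields.YangMills.Theorems.BalabanUVNodesN07FaceDatumGeometry

/-!
# BalabanUVNodes ∕ N07 ([Balaban1985Variational] Thm 1 (7)–(8), node00-def-P11's typed readings FILE 8 §7 ∕ FILE 9 ∕ FILE 10) — THE FACE DATUM AND ITS
# AVERAGE OF RECORD: one twisted FACE of a block (all `L^{d−1}` fine bonds from `B(0)` into `B(e_{μ₀})` carry `h`) averages, under Bałaban's (0.4)
# averaging of record, to ONE twisted COARSE bond (`Ū⟨0, μ₀⟩ = h`, `Ū = 1` elsewhere) — by LOCALITY and GAUGE COVARIANCE alone, no loop bookkeeping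

Cell `pub-ymgap`, seat `pub-ymgap-dag-n07-e` generation 8 (R141 (C), DAG node N07 = [15]; ROW P11 negative side, this seat's LOCATED-M4 «free δ₀»,
INBOX l.17944, and INTENT-C′ l.18065).  Part A2 of the kernel certificate of M4 (A1 = `…N07FaceDatumGeometry`: coarse sites, cube, co-divergence; part B = `…N07Thm1FreeLevelZeroObstruction`).  `--kind proof --supports
stmt-QuantumFields-20289 --as helper`.  THEOREMS ONLY (0 `def`, 0 `sorry`, 0 `instance`); the datum is the explicit lambda
`U b = if blockOf b.src = 0 ∧ blockOf b.tgt = 0 + e_{μ₀} then h else 1`, carried as the hypothesis `hU` of each statement.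

WHAT THIS FILE DOES (torus `P`, levels `0 → 1`, standing range `1 ≤ m + K`, `3 ≤ |T⁽¹⁾|` per direction; any gauge group).
* §1 THE FACE DATUM: bond values in `{1, h}` (`dist1 (U(∂q)) ≤ 4·dist1 h` for every plaquette — also for every two-valued field), and LEVEL-0
  INVISIBILITY: every fine plaquette none of whose sides has both endpoints in a region containing `B(0) ∪ B(e_{μ₀})` (def-P11's `Sect2.plaqNoBondIn`)
  has `U(∂q) = 1`.
* §2 ★ ITS AVERAGE: `avgFun ℰ U = (c ↦ if c = ⟨0, μ₀⟩ then h else 1)` for every inner average `ℰ` with `ℰ.E(1,…,1) = 1` (so for `avOfRecord`):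
  on the window of `c⋆ = ⟨0, μ₀⟩` the face datum IS the pure gauge of `λ_slab = h·𝟙{blockOf(·)_{μ₀} = 0}`, on the window of every other coarse bond meeting
  `0` it IS the pure gauge of `λ_up = h⁻¹·𝟙{blockOf(·) = e_{μ₀}}`, and off `0` it is `1` — then `BlockAveraging.avgFun_local` + `avgFun_covariant`
  ([B7] (11)) + `avgFun_one` evaluate the average with NO loop-word analysis; ★ the coarse plaquette `⟨0, μ₀, ν⟩` of `Ū` equals `h` EXACTLY.

HONEST FRAMING: kernel bookkeeping about the TREE's own averaging (`avgFun`, any `ℰ`) and def-P11's typed co-divergence; nothing of Bałaban asserted or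
refuted; N07 ∕ K0⁗ NOT discharged; counts unmoved (5∕27); one finite T⁴ programme at fixed ε — NOT continuum ∕ ℝ⁴ ∕ OS ∕ mass gap ∕ Clay.

DEPENDENCES (by name): `Setup.(blockOf, emb, GaugeField.gaugeAct, plaqHol, PBond, Site.shift∕unshift)`, `TorusGeometry.Site.(blockOf_emb, val_blockOf)`,
`TorusHypercubicSymmetry.Site.(shift_apply, unshift_apply, shift_comm)`, `B10StarCount.(blockOf_shift, unshift_shift, shift_unshift)`,
`BlockAveraging.(avgFun_local, avgFun_covariant)`, `T3DescentFibreTower.(avgFun_one, expMeanLogSU_E_one)`, `Node00.(cubeEnl_zero_eq, boxLo, boxHi)`,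
`T4AxialGaugeSmallField.castSite(_apply)`, def-P11 FILE 9 `Sect2.(coDivSum, coDivTerm, plaqMat)`, r11 `coe_ιSU`, `Node00.Sect2.plaqNoBondIn`.
-/

noncomputable section

namespace Summit.QuantumFields.YangMills.BalabanUVNodes.N07FaceDatumAverage

open Literature.MathematicalPhysics.QuantumFieldTheory.Balaban1983to89
open Literature.MathematicalPhysics.QuantumFieldTheory.Balaban1983to89.T4Continuum (T4Family)
open Literature.MathematicalPhysics.QuantumFieldTheory.Balaban1983to89.Node00
open Literature.MathematicalPhysics.QuantumFieldTheory.Balaban1983to89.B15DeterminingSets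
open BlockAveraging (avgFun avgFun_local avgFun_covariant)
open T3DescentFibreTower (avgFun_one expMeanLogSU_E_one)
open scoped Matrix.Norms.L2Operator

/-! ## §1  The face datum: two-valued, its plaquettes, its invisibility at level 0 -/

section Face

variable {P : Params} {j : ℕ} {G : Type*} [GaugeGroup G]

/-- **A TWO-VALUED FIELD HAS PLAQUETTES WITHIN `4·dist1 h` OF `1`** (`|ab − 1| ≤ |a − 1| + |b − 1|`, `|a⁻¹ − 1| = |a − 1|`). [cite: Balaban1985Averaging, (19) p.21 (bookkeeping)] -/
theorem dist1_plaqHol_le_four_mul_of_values {U : GaugeField P j G} {h : G} (hU : ∀ b, U b = 1 ∨ U b = h) (q : Plaq P j) :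
    dist1 (GaugeField.plaqHol U q) ≤ 4 * dist1 h := by
  have hb : ∀ b, dist1 (U b) ≤ dist1 h := fun b => by
    rcases hU b with h1 | h1
    · rw [h1, GaugeGroup.dist1_one]; exact GaugeGroup.dist1_nonneg h
    · rw [h1]
  unfold GaugeField.plaqHol
  set a := U ⟨q.src, q.μ⟩
  set b := U ⟨q.src.shift q.μ, q.ν⟩
  set c := U ⟨q.src.shift q.ν, q.μ⟩
  set e := U ⟨q.src, q.ν⟩
  have h1 := GaugeGroup.dist1_mul_le (a * b * c⁻¹) e⁻¹
  have h2 := GaugeGroup.dist1_mul_le (a * b) c⁻¹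
  have h3 := GaugeGroup.dist1_mul_le a b
  rw [GaugeGroup.dist1_inv] at h1 h2
  linarith [hb ⟨q.src, q.μ⟩, hb ⟨q.src.shift q.μ, q.ν⟩, hb ⟨q.src.shift q.ν, q.μ⟩, hb ⟨q.src, q.ν⟩]

variable {μ0 : Fin P.d} {h : G} {U : GaugeField P 0 G}
  (hU : ∀ b : PBond P 0, U b = if blockOf b.src = 0 ∧ blockOf b.tgt = (0 : Site P 1).shift μ0 then h else 1)
include hU

/-- The face datum is two-valued. [folklore] -/
theorem face_values (b : PBond P 0) : U b = 1 ∨ U b = h := by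
  rw [hU b]; split_ifs
  · exact Or.inr rfl
  · exact Or.inl rfl

/-- Off `B(0)` (by source block) the face datum is `1`. [folklore] -/
theorem face_eq_one_of_blockOf_src_ne {b : PBond P 0} (hb : blockOf b.src ≠ 0) : U b = 1 := by
  rw [hU b, if_neg (fun h' => hb h'.1)]

/-- **THE FACE DATUM'S PLAQUETTES ARE WITHIN `4·dist1 h` OF `1`** (fine level). [cite: Balaban1985Averaging, (19) p.21 (bookkeeping)] -/
theorem dist1_plaqHol_face_le (q : Plaq P 0) : dist1 (GaugeField.plaqHol U q) ≤ 4 * dist1 h :=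
  dist1_plaqHol_le_four_mul_of_values (face_values hU) q

/-- **LEVEL-0 INVISIBILITY OF THE FACE DATUM**: if a region `D` contains the blocks `B(0)` and `B(e_{μ₀})` (as fine sites), then every fine plaquette
with NO side having both endpoints in `D` — def-P11's `Sect2.plaqNoBondIn Ω 0` with `Ω 1 = D` — has trivial holonomy under the face datum (each
twisted bond runs from `B(0)` to `B(e_{μ₀})`, inside `D`). [cite: Balaban1985Variational, (7) p.278 (the printed range at level 0; bookkeeping)] -/
theorem plaqHol_face_eq_one_of_plaqNoBondIn {Ω : ℕ → Set (Site P 0)} (h0 : ∀ x : Site P 0, blockOf x = 0 → x ∈ Ω 1)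
    (h1 : ∀ x : Site P 0, blockOf x = (0 : Site P 1).shift μ0 → x ∈ Ω 1) {q : Plaq P 0} (hq : q ∈ Sect2.plaqNoBondIn Ω 0) :
    GaugeField.plaqHol U q = 1 := by
  obtain ⟨hq1, hq2, hq3, hq4⟩ := hq
  -- a bond whose two endpoints are not both in `Ω 1 = pts 0 (Ω 1)` carries `1`
  have key : ∀ b : PBond P 0, ¬ (b.src ∈ pts 0 (Ω (0 + 1)) ∧ b.tgt ∈ pts 0 (Ω (0 + 1))) → U b = 1 := by
    intro b hb
    rw [hU b]
    split_ifs with hc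
    · exact absurd ⟨h0 _ hc.1, h1 _ hc.2⟩ hb
    · rfl
  have e1 : U ⟨q.src, q.μ⟩ = 1 := key _ hq1
  have e2 : U ⟨q.src.shift q.μ, q.ν⟩ = 1 := key _ hq2
  have e3 : U ⟨q.src.shift q.ν, q.μ⟩ = 1 := key _ (by
    show ¬ (q.src.shift q.ν ∈ _ ∧ (q.src.shift q.ν).shift q.μ ∈ _)
    rw [Site.shift_comm q.src q.ν q.μ]; exact hq3)
  have e4 : U ⟨q.src, q.ν⟩ = 1 := key _ hq4
  unfold GaugeField.plaqHol
  rw [e1, e2, e3, e4]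
  group

omit hU in
/-- **A TOP-LEVEL PLAQUETTE WHOSE THREE LOWER CORNERS LIE IN `Γ₁` IS PINNED BY THE FIBRE**: two multi-scale fields agreeing on the determining set `genSet Ω 1`
have the same level-1 holonomy around it (all four bonds meet `Γ₁`; r12 `bondsOf` = «at least one endpoint»). [cite: Balaban1988Convergent, (2.10) p.256 (bookkeeping)] -/
theorem plaqHol_top_eq_of_agreeOn {Ω : ℕ → Set (Site P 0)} {V W : MSField P G} (hA : AgreeOn (genSet Ω 1) V W) (q : Plaq P 1)
    (h1 : q.src ∈ genSet Ω 1 1) (h2 : q.src.shift q.μ ∈ genSet Ω 1 1) (h3 : q.src.shift q.ν ∈ genSet Ω 1 1) :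
    GaugeField.plaqHol (V 1) q = GaugeField.plaqHol (W 1) q := by
  unfold GaugeField.plaqHol
  rw [hA 1 ⟨q.src, q.μ⟩ (Or.inl h1), hA 1 ⟨q.src.shift q.μ, q.ν⟩ (Or.inl h2), hA 1 ⟨q.src.shift q.ν, q.μ⟩ (Or.inl h3),
    hA 1 ⟨q.src, q.ν⟩ (Or.inl h1)]

end Face

/-! ## §2  ★ The average of the face datum: one twisted coarse bond — by locality and gauge covariance -/

section Average

variable {P : Params} {G : Type*} [GaugeGroup G] (ℰ : LoopAverage G) (hE : ∀ n : ℕ, ℰ.E (fun _ : Fin (n + 1) => (1 : G)) = 1)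
  (hj : 0 + 1 ≤ P.m + P.K) (hn : 3 ≤ P.sitesPerDir 1)
  {μ0 : Fin P.d} {h : G} {U : GaugeField P 0 G}
  (hU : ∀ b : PBond P 0, U b = if blockOf b.src = 0 ∧ blockOf b.tgt = (0 : Site P 1).shift μ0 then h else 1)

include hj in
/-- The block of the far end of a fine bond is the block of its near end or the next block in the bond's direction (`B10StarCount.blockOf_shift`).
[cite: Balaban1987RG1, (0.3) p.252 (bookkeeping)] -/
theorem blockOf_tgt_cases (b : PBond P 0) : blockOf b.tgt = blockOf b.src ∨ blockOf b.tgt = (blockOf b.src).shift b.dir := by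
  have hb := B10StarCount.blockOf_shift hj b.src b.dir
  change blockOf b.tgt = _ at hb
  rw [hb]
  split_ifs
  · exact Or.inr rfl
  · exact Or.inl rfl

include hj hn hU in
/-- **ON THE WINDOW OF `c⋆ = ⟨0, μ₀⟩` THE FACE DATUM IS THE PURE GAUGE OF THE SLAB TRANSFORMATION** `λ(z) = h` if `blockOf(z)_{μ₀} = 0`, else `1`:
on every fine bond issuing from `B(0) ∪ B(e_{μ₀})`, `U(b) = λ(b₋)·λ(b₊)⁻¹`. [cite: Balaban1985Averaging, (8),(11) p.19 (bookkeeping)] -/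
theorem face_eq_gaugeAct_slab_on_window (b : PBond P 0)
    (hb : blockOf b.src = (⟨0, μ0⟩ : PBond P 1).src ∨ blockOf b.src = (⟨0, μ0⟩ : PBond P 1).tgt) :
    U b = GaugeField.gaugeAct (fun z : Site P 0 => if (blockOf z) μ0 = 0 then h else 1) 1 b := by
  change blockOf b.src = 0 ∨ blockOf b.src = (0 : Site P 1).shift μ0 at hb
  show U b = (if (blockOf b.src) μ0 = 0 then h else 1) * 1 * (if (blockOf b.tgt) μ0 = 0 then h else 1)⁻¹
  rw [mul_one, hU b]
  rcases hb with hs | hs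
  · -- source in `B(0)`: `λ(b₋) = h`
    rw [hs, show ((0 : Site P 1) μ0 = 0) from rfl, if_pos rfl]
    rcases blockOf_tgt_cases hj b with ht | ht
    · -- far end in `B(0)` too: untwisted, `h·h⁻¹`
      rw [ht, hs, show ((0 : Site P 1) μ0 = 0) from rfl, if_pos rfl, mul_inv_cancel,
        if_neg (fun hc => shift_zero_ne_zero hn μ0 hc.2.symm)]
    · rw [ht, hs, shift_zero_apply]
      by_cases hd : μ0 = b.dir
      · -- the bond crosses the face: twisted, `λ(b₊) = 1`
        subst hd
        rw [if_pos rfl, if_neg (one_ne_zero_zmod hn), inv_one, mul_one, if_pos ⟨rfl, rfl⟩]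
      · rw [if_neg hd, if_pos rfl, mul_inv_cancel, if_neg (fun hc => hd (shift_zero_inj hn hc.2).symm)]
  · -- source in `B(e_{μ₀})`: untwisted, `λ(b₋) = λ(b₊) = 1`
    rw [if_neg (fun hc => shift_zero_ne_zero hn μ0 (hs.symm.trans hc.1)), hs, shift_zero_apply, if_pos rfl,
      if_neg (one_ne_zero_zmod hn), one_mul]
    rcases blockOf_tgt_cases hj b with ht | ht
    · rw [ht, hs, shift_zero_apply, if_pos rfl, if_neg (one_ne_zero_zmod hn), inv_one]
    · rw [ht, hs, if_neg (shift_shift_zero_apply_ne_zero hn μ0 b.dir), inv_one]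

include hE hj hn hU in
/-- ★ **THE FACE DATUM AVERAGES TO `h` ON `c⋆ = ⟨0, μ₀⟩`**: `Ū(c⋆) = λ(emb 0)·1̄(c⋆)·λ(emb e_{μ₀})⁻¹ = h·1·1` (locality + covariance [B7] (11) + `1̄ = 1`).
[cite: Balaban1985Averaging, (11) p.19; Balaban1987RG1, (0.4) p.253 (bookkeeping)] -/
theorem avgFun_face_star : avgFun ℰ U ⟨0, μ0⟩ = h := by
  rw [avgFun_local ℰ hj U (GaugeField.gaugeAct (fun z : Site P 0 => if (blockOf z) μ0 = 0 then h else 1) 1) ⟨0, μ0⟩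
    (fun b hb => face_eq_gaugeAct_slab_on_window hj hn hU b hb), avgFun_covariant ℰ hj, avgFun_one ℰ hE]
  show (if (blockOf (emb (0 : Site P 1))) μ0 = 0 then h else 1) * 1 *
    (if (blockOf (emb ((0 : Site P 1).shift μ0))) μ0 = 0 then h else 1)⁻¹ = h
  rw [Site.blockOf_emb hj, Site.blockOf_emb hj, show ((0 : Site P 1) μ0 = 0) from rfl, if_pos rfl, shift_zero_apply, if_pos rfl,
    if_neg (one_ne_zero_zmod hn), inv_one, mul_one, mul_one]

include hj hn hU in
/-- **ON THE WINDOW OF ANY OTHER COARSE BOND MEETING `0` THE FACE DATUM IS THE PURE GAUGE OF `λ_up(z) = h⁻¹·𝟙{blockOf z = e_{μ₀}}`** — the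
block `B(e_{μ₀})` is not one of the bond's two blocks, and a window bond lands in `B(e_{μ₀})` only from `B(0)` in direction `μ₀`
(`e_κ + e_κ′ ≠ e_{μ₀}`, `−e_κ + e_κ′ ≠ e_{μ₀}`). [cite: Balaban1985Averaging, (8),(11) p.19 (bookkeeping)] -/
theorem face_eq_gaugeAct_up_on_window (c : PBond P 1) (hc0 : c.src = 0 ∨ c.tgt = 0) (hc : c ≠ ⟨0, μ0⟩) (b : PBond P 0)
    (hb : blockOf b.src = c.src ∨ blockOf b.src = c.tgt) :
    U b = GaugeField.gaugeAct (fun z : Site P 0 => if blockOf z = (0 : Site P 1).shift μ0 then h⁻¹ else 1) 1 b := by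
  -- `e_{μ₀}` is not one of `c`'s blocks, and which of `c`'s blocks may be the source of a bond landing in `B(e_{μ₀})`
  have hblocks : c.src ≠ (0 : Site P 1).shift μ0 ∧ c.tgt ≠ (0 : Site P 1).shift μ0 ∧
      ∀ w : Site P 1, (w = c.src ∨ w = c.tgt) → w ≠ 0 → ∀ κ, w.shift κ ≠ (0 : Site P 1).shift μ0 := by
    obtain ⟨w, κ⟩ := c
    change w = 0 ∨ w.shift κ = 0 at hc0
    rcases hc0 with hw | hw
    · subst hw
      have hκ : κ ≠ μ0 := fun h' => hc (by subst h'; rfl)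
      refine ⟨(shift_zero_ne_zero hn μ0).symm, fun h' => hκ (shift_zero_inj hn h'), ?_⟩
      intro w' hw' hw'0 κ'
      change w' = 0 ∨ w' = (0 : Site P 1).shift κ at hw'
      rcases hw' with rfl | rfl
      · exact absurd rfl hw'0
      · exact shift_shift_zero_ne_shift hn κ κ' μ0
    · have hw' : w = (0 : Site P 1).unshift κ := by rw [← B10StarCount.unshift_shift w κ, hw]
      subst hw'
      refine ⟨unshift_zero_ne_shift hn κ μ0, ?_, ?_⟩
      · change ((0 : Site P 1).unshift κ).shift κ ≠ _; rw [hw]; exact (shift_zero_ne_zero hn μ0).symm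
      · intro w' hw' hw'0 κ'
        change w' = (0 : Site P 1).unshift κ ∨ w' = ((0 : Site P 1).unshift κ).shift κ at hw'
        rw [hw] at hw'
        rcases hw' with rfl | rfl
        · exact unshift_zero_shift_ne_shift hn κ κ' μ0
        · exact absurd rfl hw'0
  obtain ⟨hsrc, htgt, hland⟩ := hblocks
  have hbs : blockOf b.src ≠ (0 : Site P 1).shift μ0 := by
    rcases hb with hb | hb
    · rw [hb]; exact hsrc
    · rw [hb]; exact htgt
  show U b = (if blockOf b.src = (0 : Site P 1).shift μ0 then h⁻¹ else 1) * 1 *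
    (if blockOf b.tgt = (0 : Site P 1).shift μ0 then h⁻¹ else 1)⁻¹
  rw [if_neg hbs, one_mul, one_mul, hU b]
  by_cases ht : blockOf b.tgt = (0 : Site P 1).shift μ0
  · -- the bond lands in `B(e_{μ₀})`: then it issues from `B(0)`
    rw [if_pos ht, inv_inv]
    have hs0 : blockOf b.src = 0 := by
      by_contra hs0
      rcases blockOf_tgt_cases hj b with ht' | ht'
      · exact hbs (ht'.symm.trans ht)
      · have hw : blockOf b.src = c.src ∨ blockOf b.src = c.tgt := hb
        exact hland (blockOf b.src) hw hs0 b.dir (ht'.symm.trans ht)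
    rw [if_pos ⟨hs0, ht⟩]
  · rw [if_neg ht, inv_one, if_neg (fun hc' => ht hc'.2)]

include hE hj hn hU in
/-- ★ **THE FACE DATUM AVERAGES TO `1` ON EVERY COARSE BOND `c ≠ c⋆` MEETING `0`** (`Ū(c) = λ_up(emb c₋)·1·λ_up(emb c₊)⁻¹ = 1`).
[cite: Balaban1985Averaging, (11) p.19; Balaban1987RG1, (0.4) p.253 (bookkeeping)] -/
theorem avgFun_face_eq_one_of_meets (c : PBond P 1) (hc0 : c.src = 0 ∨ c.tgt = 0) (hc : c ≠ ⟨0, μ0⟩) : avgFun ℰ U c = 1 := by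
  have hsrc : c.src ≠ (0 : Site P 1).shift μ0 := by
    obtain ⟨w, κ⟩ := c
    change w = 0 ∨ w.shift κ = 0 at hc0
    rcases hc0 with hw | hw
    · subst hw; exact (shift_zero_ne_zero hn μ0).symm
    · have hw' : w = (0 : Site P 1).unshift κ := by rw [← B10StarCount.unshift_shift w κ, hw]
      subst hw'; exact unshift_zero_ne_shift hn κ μ0
  have htgt : c.tgt ≠ (0 : Site P 1).shift μ0 := by
    obtain ⟨w, κ⟩ := c
    change w = 0 ∨ w.shift κ = 0 at hc0
    change w.shift κ ≠ _
    rcases hc0 with hw | hw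
    · subst hw
      exact fun h' => hc (by rw [shift_zero_inj hn h'.symm])
    · rw [hw]; exact (shift_zero_ne_zero hn μ0).symm
  rw [avgFun_local ℰ hj U (GaugeField.gaugeAct (fun z : Site P 0 => if blockOf z = (0 : Site P 1).shift μ0 then h⁻¹ else 1) 1) c
    (fun b hb => face_eq_gaugeAct_up_on_window hj hn hU c hc0 hc b hb), avgFun_covariant ℰ hj, avgFun_one ℰ hE]
  show (if blockOf (emb c.src) = (0 : Site P 1).shift μ0 then h⁻¹ else 1) * 1 *
    (if blockOf (emb c.tgt) = (0 : Site P 1).shift μ0 then h⁻¹ else 1)⁻¹ = 1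
  rw [Site.blockOf_emb hj, Site.blockOf_emb hj, if_neg hsrc, if_neg htgt, inv_one, mul_one, mul_one]

include hE hj hU in
/-- **OFF `B(0)` THE FACE DATUM AVERAGES TO `1`**: a coarse bond neither of whose blocks is `B(0)` sees only untwisted bonds. [cite: Balaban1987RG1, (0.4) p.253 (locality; bookkeeping)] -/
theorem avgFun_face_eq_one_of_not_meets (c : PBond P 1) (hc : c.src ≠ 0 ∧ c.tgt ≠ 0) : avgFun ℰ U c = 1 := by
  rw [avgFun_local ℰ hj U 1 c (fun b hb => ?_), avgFun_one ℰ hE]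
  · rfl
  · have hbs : blockOf b.src ≠ 0 := by
      rcases hb with hb | hb
      · rw [hb]; exact hc.1
      · rw [hb]; exact hc.2
    exact face_eq_one_of_blockOf_src_ne hU hbs

include hE hj hn hU in
/-- ★★ **THE AVERAGE OF THE FACE DATUM IS THE SINGLE TWISTED COARSE BOND**: `Ū(c) = h` if `c = ⟨0, μ₀⟩`, `1` otherwise.
[cite: Balaban1987RG1, (0.4) p.253; Balaban1985Averaging, (11) p.19 (bookkeeping)] -/
theorem avgFun_face (c : PBond P 1) : avgFun ℰ U c = if c = ⟨0, μ0⟩ then h else 1 := by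
  by_cases hc : c = ⟨0, μ0⟩
  · subst hc; rw [if_pos rfl]; exact avgFun_face_star ℰ hE hj hn hU
  · rw [if_neg hc]
    by_cases hc0 : c.src = 0 ∨ c.tgt = 0
    · exact avgFun_face_eq_one_of_meets ℰ hE hj hn hU c hc0 hc
    · rw [not_or] at hc0
      exact avgFun_face_eq_one_of_not_meets ℰ hE hj hU c hc0

include hE hj hn hU in
/-- The averaged face datum is two-valued. [folklore] -/
theorem avgFun_face_values (c : PBond P 1) : avgFun ℰ U c = 1 ∨ avgFun ℰ U c = h := by
  rw [avgFun_face ℰ hE hj hn hU c]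
  split_ifs
  · exact Or.inr rfl
  · exact Or.inl rfl

include hE hj hn hU in
/-- **THE COARSE PLAQUETTES OF THE AVERAGED FACE DATUM ARE WITHIN `4·dist1 h` OF `1`.** [cite: Balaban1985Averaging, (19) p.21 (bookkeeping)] -/
theorem dist1_plaqHol_avgFun_face_le (q : Plaq P 1) : dist1 (GaugeField.plaqHol (avgFun ℰ U) q) ≤ 4 * dist1 h :=
  dist1_plaqHol_le_four_mul_of_values (avgFun_face_values ℰ hE hj hn hU) q

include hE hj hn hU in
/-- ★ **THE COARSE PLAQUETTE `⟨0, μ₀, ν⟩` OF THE AVERAGED FACE DATUM IS EXACTLY `h`** (its other three bonds are `≠ c⋆`).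
[cite: Balaban1985Averaging, (9) p.19 (bookkeeping)] -/
theorem plaqHol_avgFun_face_star {ν : Fin P.d} (hμν : μ0 < ν) :
    GaugeField.plaqHol (avgFun ℰ U) ⟨0, μ0, ν, hμν⟩ = h := by
  have hν : ν ≠ μ0 := fun h' => (lt_irrefl _) (h' ▸ hμν)
  unfold GaugeField.plaqHol
  simp only
  rw [avgFun_face ℰ hE hj hn hU, avgFun_face ℰ hE hj hn hU, avgFun_face ℰ hE hj hn hU, avgFun_face ℰ hE hj hn hU, if_pos rfl,
    if_neg, if_neg, if_neg, inv_one, mul_one, mul_one, mul_one]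
  · intro h'; cases h'; exact hν rfl
  · intro h'
    have := (PBond.mk.injEq _ _ _ _).mp h'
    exact shift_zero_ne_zero hn ν this.1
  · intro h'
    have := (PBond.mk.injEq _ _ _ _).mp h'
    exact shift_zero_ne_zero hn μ0 this.1

end Average

end Summit.QuantumFields.YangMills.BalabanUVNodes.N07FaceDatumAverage

end
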